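import Literature.AlgebraicGeometry.Motives.AnalytificationTautologicalBundle
import Literature.NumberTheory.Transcendental.ComplexDeRhamRealStructure
import HarnessLib

/-!
# The restricted Fubini–Study form is exact on each affine chart of a projective manifold

Family `hodge`, layer `Literature/AlgebraicGeometry/Motives`. Companion of
`GAGAKaehlerImmersionProofs` (the Kähler form `θ = Gⱼ^*β₀` of the analytification of a closed
subscheme `ι : X ⟶ ℙᴺ_k`, `β₀ = dα₀` the Fubini–Study form of `ℂᴺ⁺¹ ∖ {0}`) and of
`AnalytificationTautologicalBundle` (`θᵖ` computes `ch_p(𝒪(-1)|_{X^an})`). On the chart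
`Mⱼ = φ⁻¹(ι⁻¹D₊(xⱼ)(ℂ))` — the complement of the hyperplane section `X ∩ {xⱼ = 0}` — the lift `Gⱼ`
is a GLOBAL holomorphic nowhere-vanishing map, so

  `θ|_{Mⱼ} = Gⱼ^*(dα₀) = d(Gⱼ^*α₀)`   and   `θᵖ⁺¹|_{Mⱼ} = d(Gⱼ^*α₀ ∧ θᵖ)`:

**the Kähler form and all its positive powers are EXACT on the open submanifold `Mⱼ`**. This is
the elementary half of "the hyperplane class is the class of a hyperplane section": the class
`[θ]ᵖ`, and with it `ch_p(𝒪(-1)|_{X^an})`, DIES on the complement of the divisor `X ∩ {xⱼ = 0}`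
(Voisin I (2002), §11.1.2 and proof of Thm. 11.33: "the Chern class `c₁(Lᵢ)` vanishes on `X − Dᵢ`,
since `Lᵢ` is trivial on `X − Dᵢ`" — here `𝒪(-1)` is trivialised on `Mⱼ` by the frame `Gⱼ`, whose
connection form `Gⱼ^*γ₀` is a global primitive of the curvature; Griffiths–Harris (1978), p. 141:
`Θ = ∂̄∂ log ‖Z‖²` is `dd^c` of a function on `Uⱼ`). Rendered on the open submanifold
`↥(chartOpens ι hφ j)` (Mathlib's manifold structure on an open subset, `T_x U = T_x M`;
`ManifoldFormsPullback`, § "Restriction to an open submanifold"). ALL PROVED: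

* `Literature.Geometry.Kaehler.fubiniStudyPotentialMForm`, `mextDeriv_fubiniStudyPotentialMForm`
  (`dα₀ = β₀` as forms on `W`), `fsPotentialPullback E G = G^*α₀`, `mextDeriv_fsPotentialPullback`
  (`d(G^*α₀) = G^*β₀` where `G` is holomorphic and non-zero),
  `fsPullback_pullback_subtypeVal_mem_exactSmoothForms` (**`G^*β₀` is exact on any open set on
  which `G` is holomorphic and non-zero**);
* `AnalytificationKaehler.chartOpens ι hφ j` (the open submanifold `Mⱼ`),
  `fubiniStudyPullbackForm_pullback_val_mem_exactSmoothForms` (**`θ|_{Mⱼ}` is exact**),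
  `kaehlerFormPow_succ_pullback_val_mem_exactSmoothForms` (**`ω_gᵖ⁺¹|_{Mⱼ}` is exact** for any
  Kähler metric `g` with `ω_g = θ`; closed ∧ exact is exact), and the complexified, rescaled form
  `smul_kaehlerFormPow_ofReal_pullback_val_mem_cexactSmoothForms` consumed by
  `Literature/AlgebraicGeometry/HodgeTheory/HolomorphicBundleChernCharacterHyperplane`
  (`ch_p(𝒪(-1)) ∈ N¹ H²ᵖ`, and `∈ algebraicClasses X 1` for `p = 1`).

## References

* C. Voisin, *Hodge Theory and Complex Algebraic Geometry I* (CUP 2002), §3.3.2 (proof of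
  Lemma 3.16: `ωᵢ = (1/2iπ) ∂∂̄ log hᵢ` on `Uᵢ`), §11.1.2, Thm. 11.33 (proof). [VoisinHodgeI2002]
* P. Griffiths, J. Harris, *Principles of Algebraic Geometry* (1978), pp. 30–31, 141. [GriffithsHarris1978]
* F. W. Warner, *Foundations of Differentiable Manifolds and Lie Groups* (1983), 2.22–2.23, 4.11. [WarnerGTM94]
-/

noncomputable section

open scoped Manifold ContDiff Topology InnerProductSpace
open CategoryTheory AlgebraicGeometry Complex Set Filter

/-! ## Part 1. `G^*β₀ = d(G^*α₀)` and exactness on open sets -/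

namespace Literature.Geometry.Kaehler

variable {E : Type*} [NormedAddCommGroup E] [NormedSpace ℂ E]
  {M : Type*} [TopologicalSpace M] [ChartedSpace E M]
  {W : Type*} [NormedAddCommGroup W] [InnerProductSpace ℂ W]

/-- The Fubini–Study potential `α₀(Z)(a) = Im⟪Z, a⟫/‖Z‖²` as a `1`-form on the manifold `W`
(modelled on itself). [cite: VoisinHodgeI2002, §3.3.2 Lemma 3.16] -/
def fubiniStudyPotentialMForm : MForm 𝓘(ℝ, W) W ℝ 1 := fun Z ↦ (fubiniStudyPotential Z :)

/-- Unfolding of `fubiniStudyPotentialMForm` (definitional). [folklore] -/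
@[simp]
theorem fubiniStudyPotentialMForm_apply (Z : W) :
    fubiniStudyPotentialMForm (W := W) Z = (fubiniStudyPotential Z :) := rfl

/-- **`dα₀ = β₀` as forms on `W`** (the Fubini–Study form was DEFINED as `extDeriv α₀`; the
manifold `d` on the model space is `extDeriv`). [cite: VoisinHodgeI2002, §3.3.1] -/
theorem mextDeriv_fubiniStudyPotentialMForm :
    mextDeriv (fubiniStudyPotentialMForm (W := W)) = fubiniStudyMForm := by
  funext Z
  rw [mextDeriv_eq_extDeriv]
  rfl

variable (E) in
/-- **The pulled-back potential `G^*α₀`** of a map `G : M → W` (meaningful where `G` is holomorphic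
and non-zero): a primitive of the pulled-back Fubini–Study form `θ_G = G^*β₀` wherever `G` is
defined — `-½ dᶜ log ‖G‖²`, the imaginary part of the connection form `G^*γ₀ = ∂ log ‖G‖²`.
[cite: GriffithsHarris1978, Ch. 1 §1 p. 141] -/
def fsPotentialPullback (G : M → W) : MForm 𝓘(ℝ, E) M ℝ 1 :=
  (fubiniStudyPotentialMForm (W := W)).pullback 𝓘(ℝ, E) G

section Smooth

variable [FiniteDimensional ℂ E] [IsManifold 𝓘(ℂ, E) ω M] [IsManifold 𝓘(ℝ, E) ∞ M]
  [FiniteDimensional ℂ W] {G : M → W} {U : Set M}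

/-- `G^*α₀` is smooth at the points of an open set where `G` is holomorphic and non-zero.
[cite: WarnerGTM94, 2.22] -/
theorem smoothAt_fsPotentialPullback (hG : MDifferentiableOn 𝓘(ℂ, E) 𝓘(ℂ, W) G U) (hU : IsOpen U)
    {m : M} (hm : m ∈ U) (h0 : G m ≠ 0) : (fsPotentialPullback E G).SmoothAt m :=
  MForm.SmoothAt.pullback (eventually_contMDiffAt_real hG hU hm)
    ((MForm.smoothAt_model_iff (fubiniStudyPotentialMForm (W := W)) _).2
      (contDiffAt_fubiniStudyPotential h0))

/-- **`d(G^*α₀) = G^*β₀` at the points where `G` is holomorphic and non-zero** (`d` commutes with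
pull-back at smooth points, `mextDeriv_pullback_apply`; `dα₀ = β₀`): the restricted Fubini–Study
form is LOCALLY EXACT (Voisin (2002), §3.3.1: Chern forms are "locally exact";
Griffiths–Harris (1978), p. 141). [cite: VoisinHodgeI2002, §3.3.1] -/
theorem mextDeriv_fsPotentialPullback (hG : MDifferentiableOn 𝓘(ℂ, E) 𝓘(ℂ, W) G U) (hU : IsOpen U)
    {m : M} (hm : m ∈ U) (h0 : G m ≠ 0) : mextDeriv (fsPotentialPullback E G) m = fsPullback E G m := by
  rw [fsPotentialPullback, mextDeriv_pullback_apply (eventually_contMDiffAt_real hG hU hm)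
    ((MForm.smoothAt_model_iff (fubiniStudyPotentialMForm (W := W)) _).2
      (contDiffAt_fubiniStudyPotential h0)), mextDeriv_fubiniStudyPotentialMForm]
  rfl

/-- **`G^*β₀` is exact on every open set on which `G` is holomorphic and non-zero**: on the open
submanifold `U` (Mathlib's manifold structure on `↥U`, `T_x U = T_x M`),
`(G^*β₀)|_U = d((G^*α₀)|_U)` with `(G^*α₀)|_U` smooth, so `(G^*β₀)|_U ∈ B²(U)` — the class of the
restricted Fubini–Study form dies wherever a global holomorphic lift to `W ∖ {0}` exists
(Voisin (2002), §11.1.2 / proof of Thm. 11.33; Griffiths–Harris (1978), p. 141).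
[cite: VoisinHodgeI2002, §3.3.1 and Thm. 11.33 (proof)] -/
theorem fsPullback_pullback_subtypeVal_mem_exactSmoothForms {U : TopologicalSpace.Opens M}
    (hG : MDifferentiableOn 𝓘(ℂ, E) 𝓘(ℂ, W) G U) (h0 : ∀ m ∈ U, G m ≠ 0) :
    (fsPullback E G).pullback 𝓘(ℝ, E) (Subtype.val : U → M) ∈ exactSmoothForms 𝓘(ℝ, E) U ℝ 2 := by
  have hsm : ∀ x : U, (fsPotentialPullback E G).SmoothAt (x : M) := fun x ↦
    smoothAt_fsPotentialPullback hG U.isOpen x.2 (h0 x x.2)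
  have hs : IsSmoothForm ((fsPotentialPullback E G).pullback 𝓘(ℝ, E) (Subtype.val : U → M)) :=
    fun x ↦ MForm.SmoothAt.pullback_subtypeVal (hsm x)
  have hd : mextDeriv ((fsPotentialPullback E G).pullback 𝓘(ℝ, E) (Subtype.val : U → M)) =
      (fsPullback E G).pullback 𝓘(ℝ, E) (Subtype.val : U → M) := by
    funext x
    ext v
    rw [mextDeriv_pullback_subtypeVal_apply (hsm x), MForm.pullback_subtypeVal_apply,
      mextDeriv_fsPotentialPullback hG U.isOpen x.2 (h0 x x.2)]
  rw [← hd]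
  simp only [exactSmoothForms]
  exact Submodule.subset_span ⟨_, hs, rfl⟩

end Smooth

end Literature.Geometry.Kaehler

/-! ## Part 2. `θ|_{Mⱼ}` and `θᵖ⁺¹|_{Mⱼ}` are exact -/

namespace Literature.AlgebraicGeometry.Motives

namespace AnalytificationKaehler

open Literature.NumberTheory.Transcendental Literature.Geometry.Kaehler Bundle

variable {k : Type} [Field k] [Algebra k ℂ] {X : SchemeOver k}
  {M : Type*} {E : Type*} [NormedAddCommGroup E] [NormedSpace ℂ E] [FiniteDimensional ℂ E]
  [TopologicalSpace M] [ChartedSpace E M]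
  {N : ℕ} (ι : X ⟶ projectiveSpace N k) {φ : M → ComplexPoints X} {d : ℕ}
  (hφ : IsAnalytification E X d φ)

/-- **The open submanifold `Mⱼ = φ⁻¹(ι⁻¹D₊(xⱼ)(ℂ))`** of the analytification — the complement of
the hyperplane section `X ∩ {xⱼ = 0}` — as an open subset (carrying Mathlib's open-submanifold
structure). [folklore] -/
def chartOpens (j : Fin (N + 1)) : TopologicalSpace.Opens M := ⟨chartDom ι φ j, isOpen_chartDom hφ j⟩

/-- Membership in `chartOpens` is membership in `chartDom` (definitional). [folklore] -/
@[simp]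
theorem mem_chartOpens_iff {j : Fin (N + 1)} {m : M} : m ∈ chartOpens ι hφ j ↔ m ∈ chartDom ι φ j :=
  Iff.rfl

/-- The carrier of `chartOpens` is `chartDom` (definitional). [folklore] -/
@[simp]
theorem coe_chartOpens (j : Fin (N + 1)) : (chartOpens ι hφ j : Set M) = chartDom ι φ j := rfl

variable [IsClosedImmersion ι.left]

/-- On `Mⱼ` the Kähler form is the pull-back `Gⱼ^*β₀` along the `j`-th lift (the choice of chart in
`fubiniStudyPullbackForm` is immaterial, `fsPullback_coordVec_eq`), as forms on the open
submanifold. [cite: VoisinHodgeI2002, §3.3.1] -/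
theorem fubiniStudyPullbackForm_pullback_val_eq (j : Fin (N + 1)) :
    (fubiniStudyPullbackForm E ι φ).pullback 𝓘(ℝ, E) (Subtype.val : chartOpens ι hφ j → M) =
      (fsPullback E (coordVec ι φ j)).pullback 𝓘(ℝ, E) (Subtype.val : chartOpens ι hφ j → M) := by
  funext x
  ext v
  rw [MForm.pullback_subtypeVal_apply, MForm.pullback_subtypeVal_apply]
  exact congrArg (fun a ↦ a v) (fsPullback_coordVec_eq hφ x.2 (mem_chartDom_chartIndex (x : M)))

variable [IsManifold 𝓘(ℂ, E) ω M] [IsManifold 𝓘(ℝ, E) ∞ M]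

/-- **The Kähler form `θ` is exact on `Mⱼ`**: `θ|_{Mⱼ} = d(Gⱼ^*α₀)` (the lift `Gⱼ` is holomorphic and
non-zero on all of `Mⱼ`). Hence the Kähler class dies on the complement of the hyperplane section
`X ∩ {xⱼ = 0}` (Voisin (2002), §11.1.2; proof of Thm. 11.33).
[cite: VoisinHodgeI2002, Thm. 11.33 (proof) and §11.1.2] -/
theorem fubiniStudyPullbackForm_pullback_val_mem_exactSmoothForms (j : Fin (N + 1)) :
    (fubiniStudyPullbackForm E ι φ).pullback 𝓘(ℝ, E) (Subtype.val : chartOpens ι hφ j → M) ∈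
      exactSmoothForms 𝓘(ℝ, E) (chartOpens ι hφ j) ℝ 2 := by
  rw [fubiniStudyPullbackForm_pullback_val_eq ι hφ j]
  exact fsPullback_pullback_subtypeVal_mem_exactSmoothForms
    ((mdifferentiableOn_coordVec hφ j).mono fun m hm ↦ hm) fun m hm ↦ coordVec_ne_zero hm

/-- **The positive powers of the Kähler form are exact on `Mⱼ`**: for a smooth Kähler metric `g`
on `M` whose Kähler form is `θ`, `ω_gᵖ⁺¹|_{Mⱼ} = ω_gᵖ|_{Mⱼ} ∧ θ|_{Mⱼ}` is closed ∧ exact, hence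
exact (`wedge_mem_exactSmoothForms_of_right`, Leibniz). So `[ω_g]ᵖ⁺¹`, i.e. the class computing
`ch_{p+1}(𝒪(-1)|_{X^an})`, dies off the hyperplane section (Voisin (2002), §11.1.2).
[cite: VoisinHodgeI2002, §11.1.2 and Thm. 11.33 (proof)] -/
theorem kaehlerFormPow_succ_pullback_val_mem_exactSmoothForms
    (g : ContMDiffRiemannianMetric 𝓘(ℝ, E) ∞ E (fun x : M ↦ TangentSpace 𝓘(ℝ, E) x))
    (hgK : g.toRiemannianMetric.IsKaehler) (hg : g.toRiemannianMetric.kaehlerForm = fubiniStudyPullbackForm E ι φ)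
    (j : Fin (N + 1)) (p : ℕ) :
    (kaehlerFormPow g.toRiemannianMetric (p + 1)).pullback 𝓘(ℝ, E) (Subtype.val : chartOpens ι hφ j → M) ∈
      exactSmoothForms 𝓘(ℝ, E) (chartOpens ι hφ j) ℝ (2 * (p + 1)) := by
  haveI : WedgeFacts 𝓘(ℝ, E) M ℝ :=
    wedgeFacts_of_assoc 𝓘(ℝ, E) M ℝ (ContinuousAlternatingMap.WedgeAssoc_holds ℝ E ℝ)
  haveI : WedgeFacts 𝓘(ℝ, E) (chartOpens ι hφ j) ℝ :=
    wedgeFacts_of_assoc 𝓘(ℝ, E) (chartOpens ι hφ j) ℝ (ContinuousAlternatingMap.WedgeAssoc_holds ℝ E ℝ)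
  have hω := isSmoothForm_kaehlerForm_of_isManifold_complex_holds (E := E) (M := M)
  have hcl : (kaehlerFormPow g.toRiemannianMetric p).pullback 𝓘(ℝ, E)
      (Subtype.val : chartOpens ι hφ j → M) ∈ closedSmoothForms 𝓘(ℝ, E) (chartOpens ι hφ j) ℝ (2 * p) :=
    pullback_mem_closedSmoothForms (fun x ↦ contMDiff_subtype_val x)
      ((mem_closedSmoothForms_iff _).2
        ⟨isSmoothForm_kaehlerFormPow hω g p, isClosedForm_kaehlerFormPow hω g hgK p⟩)
  rw [kaehlerFormPow_succ, MForm.pullback_castDeg, MForm.pullback_wedge, hg]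
  exact castDeg_mem_exactSmoothForms _
    (wedge_mem_exactSmoothForms_of_right hcl (fubiniStudyPullbackForm_pullback_val_mem_exactSmoothForms ι hφ j))

/-- Complexified and rescaled: for `p ≥ 1` and any `c : ℂ`, the restriction to `Mⱼ` of
`c · ω_gᵖ ⊗ 1` — the global `p`-th Chern character form of `𝒪(-1)|_{X^an}` when
`c = (1/p!) (-1/2π)ᵖ` (`HodgeModel.isChernCharacterForm_tautologicalConnection`) — is an exact
smooth complex form on the open submanifold `Mⱼ`. [cite: VoisinHodgeI2002, Thm. 11.33 (proof)] -/
theorem smul_kaehlerFormPow_ofReal_pullback_val_mem_cexactSmoothForms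
    (g : ContMDiffRiemannianMetric 𝓘(ℝ, E) ∞ E (fun x : M ↦ TangentSpace 𝓘(ℝ, E) x))
    (hgK : g.toRiemannianMetric.IsKaehler) (hg : g.toRiemannianMetric.kaehlerForm = fubiniStudyPullbackForm E ι φ)
    (j : Fin (N + 1)) (c : ℂ) {p : ℕ} (hp : 1 ≤ p) :
    (c • (kaehlerFormPow g.toRiemannianMetric p).ofReal).pullback 𝓘(ℝ, E)
        (Subtype.val : chartOpens ι hφ j → M) ∈
      cexactSmoothForms E (chartOpens ι hφ j) (2 * p) := by
  obtain ⟨q, rfl⟩ : ∃ q, p = q + 1 := ⟨p - 1, by omega⟩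
  have h1 : (c • (kaehlerFormPow g.toRiemannianMetric (q + 1)).ofReal).pullback 𝓘(ℝ, E)
        (Subtype.val : chartOpens ι hφ j → M) =
      c • ((kaehlerFormPow g.toRiemannianMetric (q + 1)).pullback 𝓘(ℝ, E)
        (Subtype.val : chartOpens ι hφ j → M)).ofReal := by
    rw [← MForm.pullback_ofReal, ← MForm.cpullbackₗ_apply, ← MForm.cpullbackₗ_apply, map_smul]
  rw [h1]
  exact Submodule.smul_mem _ c (ofReal_mem_cexactSmoothForms
    (kaehlerFormPow_succ_pullback_val_mem_exactSmoothForms ι hφ g hgK hg j q))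

end AnalytificationKaehler

end Literature.AlgebraicGeometry.Motives

end
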